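import Summits.RiemannHypothesis.RiemannHypothesis.Theorems.LiDirichletAsymptoticDefs
import Summits.RiemannHypothesis.RiemannHypothesis.Theorems.LiDirichletAsymptoticCountNumerics
import Literature.NumberTheory.LFunctions.DirichletLZeroCountingCentralSlope
import Literature.NumberTheory.LFunctions.ExplicitFormulaPsiCharZeros
import Literature.NumberTheory.LFunctions.SchoenfeldZeroSums
import HarnessLib

/-!
# RiemannHypothesis / LiDirichletAsymptotic — the two-sided zero count `N(t, χ)`: windows, partial summation,
# and the tree's remainder AT EVERY HEIGHT (RH-FREE · GRH-FREE)

RH-FREE · GRH-FREE PROOF-OF-DATA (rung L-P(P1⁺χ)) [rh-li-prover].  Route `Theses/LiDirichletAsymptotic.lean`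
(cell `pub/rh-li`); shared bookkeeping for the items `LiOscillatoryChar` (19628), `LiFarTailsChar` (19632),
`LiLowZerosChar` (19633).  `N(t) = lfunctionZeroCount χ t` (zeros with `0 < Re ρ < 1`, `|Im ρ| ≤ t`, multiplicity
`zeroOrder`):

* windows: `N(b) − N(a)`, `charWeightTrace χ n b − charWeightTrace χ n a` and `charInvMomentTail χ k a b` are sums
  over the same finite set `box b \ box a` (`a ≤ b`); `N` is monotone;
* PARTIAL SUMMATION against `N` (Rosser–Schoenfeld Lemma 7, χ-twin of the tree's `SchoenfeldBound.sum_zerosBetween_eq`):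
  `∑_{a<|γ|≤b} m F(|γ|) = (N(b) − N(a)) F(b) − ∫_a^b (N(t) − N(a)) F'(t) dt` for `F ∈ C¹[a, b]`, `0 ≤ a ≤ b`;
* the tree's RH-free remainder (`DirichletTheta.abs_lfunctionZeroCount_sub_le`, MV Cor. 14.7 with the `Γ`-phase
  exact, valid OFF ordinates) EXTENDED TO EVERY `t > 0` by monotonicity of `N` and continuity of the main term and
  the majorant (ordinates are isolated): `|N(t) − charCountMainExact χ t| ≤ 5 + 2 log(2 ζ(5/4) q(t+4))/log(7/6)
  ≤ argSRem q t + 0.014` (`CountNumerics.remainder_le`: `ζ(5/4) ≤ 4.6`, `2/log(7/6) ≤ 12.975`).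

Nothing here bears on the truth of RH or GRH.
-/

noncomputable section

-- D-0017: `Summit.<S>.<S>.…` is the designed namespace of a single-problem summit.
set_option linter.dupNamespace false

open MeasureTheory intervalIntegral Set Filter
open scoped Topology

namespace Summit.RiemannHypothesis.RiemannHypothesis.Theorems.LiTheory

open Literature.NumberTheory.LFunctions Literature.NumberTheory.LFunctions.ExplicitPsiChar
open Literature.NumberTheory.LFunctions.DirichletTheta
open Literature.NumberTheory.LFunctions.DirichletDisc (zeroOrder)

namespace CharCount

variable {q : ℕ} [NeZero q] {χ : DirichletCharacter ℂ q}

/-! ### Boxes and windows -/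

/-- The boxes increase with the height. -/
theorem box_mono (χ : DirichletCharacter ℂ q) {a b : ℝ} (hab : a ≤ b) :
    lfunctionZeroBox χ a ⊆ lfunctionZeroBox χ b := fun ρ hρ ↦ by
  obtain ⟨hz, h0, h1, ha⟩ := mem_lfunctionZeroBox.1 hρ
  exact mem_lfunctionZeroBox.2 ⟨hz, h0, h1, ha.trans hab⟩

/-- Membership in the window `box b \ box a`: a zero with `a < |Im ρ| ≤ b`. -/
theorem mem_window {a b : ℝ} {ρ : ℂ} :
    ρ ∈ lfunctionZeroBox χ b \ lfunctionZeroBox χ a ↔ ρ ∈ lfunctionZeroBox χ b ∧ a < |ρ.im| := by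
  rw [Set.mem_sdiff]
  constructor
  · rintro ⟨hb, hna⟩
    refine ⟨hb, not_le.1 fun hle ↦ hna ?_⟩
    obtain ⟨hz, h0, h1, -⟩ := mem_lfunctionZeroBox.1 hb
    exact mem_lfunctionZeroBox.2 ⟨hz, h0, h1, hle⟩
  · rintro ⟨hb, hlt⟩
    exact ⟨hb, fun hmem ↦ (not_le.2 hlt) (mem_lfunctionZeroBox.1 hmem).2.2.2⟩

/-- A finsum over the window is the difference of the finsums over the boxes (`a ≤ b`, `χ ≠ χ₀`). -/
theorem finsum_window_eq_sub (hχ1 : χ ≠ 1) {a b : ℝ} (hab : a ≤ b) (g : ℂ → ℝ) :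
    ∑ᶠ ρ ∈ lfunctionZeroBox χ b \ lfunctionZeroBox χ a, g ρ =
      (∑ᶠ ρ ∈ lfunctionZeroBox χ b, g ρ) - ∑ᶠ ρ ∈ lfunctionZeroBox χ a, g ρ := by
  classical
  have hfb := lfunctionZeroBox_finite hχ1 b
  have hfa := lfunctionZeroBox_finite hχ1 a
  have hfd : (lfunctionZeroBox χ b \ lfunctionZeroBox χ a).Finite := hfb.subset fun _ h ↦ h.1
  rw [finsum_mem_eq_finite_toFinset_sum _ hfd, finsum_mem_eq_finite_toFinset_sum _ hfb,
    finsum_mem_eq_finite_toFinset_sum _ hfa]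
  have hsub : hfa.toFinset ⊆ hfb.toFinset := by
    intro ρ hρ
    rw [Set.Finite.mem_toFinset] at hρ ⊢
    exact box_mono χ hab hρ
  have hdiff : hfd.toFinset = hfb.toFinset \ hfa.toFinset := by
    ext ρ
    rw [Set.Finite.mem_toFinset, Finset.mem_sdiff, Set.Finite.mem_toFinset, Set.Finite.mem_toFinset, Set.mem_sdiff]
  rw [hdiff, ← Finset.sum_sdiff hsub]
  ring

/-- The count as a real Finset sum. -/
theorem count_eq_sum (hχ1 : χ ≠ 1) (T : ℝ) :
    (lfunctionZeroCount χ T : ℝ) = ∑ ρ ∈ (lfunctionZeroBox_finite hχ1 T).toFinset, (zeroOrder χ ρ : ℝ) := by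
  unfold lfunctionZeroCount
  rw [finsum_mem_eq_finite_toFinset_sum _ (lfunctionZeroBox_finite hχ1 T)]
  push_cast
  rfl

/-- The count as a real finsum. -/
theorem count_eq_finsum (hχ1 : χ ≠ 1) (T : ℝ) :
    (lfunctionZeroCount χ T : ℝ) = ∑ᶠ ρ ∈ lfunctionZeroBox χ T, (zeroOrder χ ρ : ℝ) := by
  rw [count_eq_sum hχ1, finsum_mem_eq_finite_toFinset_sum _ (lfunctionZeroBox_finite hχ1 T)]

/-- `N(b) − N(a) = ∑_{a < |γ| ≤ b} m` (`a ≤ b`). -/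
theorem count_sub_eq (hχ1 : χ ≠ 1) {a b : ℝ} (hab : a ≤ b) :
    (lfunctionZeroCount χ b : ℝ) - lfunctionZeroCount χ a =
      ∑ᶠ ρ ∈ lfunctionZeroBox χ b \ lfunctionZeroBox χ a, (zeroOrder χ ρ : ℝ) := by
  rw [finsum_window_eq_sub hχ1 hab, count_eq_finsum hχ1, count_eq_finsum hχ1]

/-- `N` is monotone in the height. -/
theorem count_mono (hχ1 : χ ≠ 1) {a b : ℝ} (hab : a ≤ b) :
    (lfunctionZeroCount χ a : ℝ) ≤ lfunctionZeroCount χ b := by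
  classical
  have hfd : (lfunctionZeroBox χ b \ lfunctionZeroBox χ a).Finite :=
    (lfunctionZeroBox_finite hχ1 b).subset fun _ h ↦ h.1
  have h := count_sub_eq hχ1 hab
  rw [finsum_mem_eq_finite_toFinset_sum _ hfd] at h
  have : 0 ≤ ∑ ρ ∈ hfd.toFinset, (zeroOrder χ ρ : ℝ) := Finset.sum_nonneg fun _ _ ↦ Nat.cast_nonneg _
  linarith

/-- The weight-trace window `charWeightTrace χ n b − charWeightTrace χ n a = ∑_{a<|γ|≤b} m f_n(|γ|)` (`a ≤ b`). -/
theorem charWeightTrace_sub (hχ1 : χ ≠ 1) (n : ℕ) {a b : ℝ} (hab : a ≤ b) :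
    charWeightTrace χ n b - charWeightTrace χ n a =
      ∑ᶠ ρ ∈ lfunctionZeroBox χ b \ lfunctionZeroBox χ a, (zeroOrder χ ρ : ℝ) * liWindowWeight₀ n |ρ.im| := by
  rw [finsum_window_eq_sub hχ1 hab]
  rfl

/-! ### Partial summation against `N(t, χ)` -/

/-- The partial counts inside the window: for `a ≤ t`,
`∑_{a < |γ| ≤ b, |γ| ≤ t} m = N(min) …` — precisely `∑_{ρ ∈ box b \ box a} m·1_{|γ| ≤ t} = N(t) − N(a)` for `a ≤ t ≤ b`. -/
theorem sum_indicator_eq_count_sub (hχ1 : χ ≠ 1) {a b t : ℝ} (hat : a ≤ t) (htb : t ≤ b)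
    (hfd : (lfunctionZeroBox χ b \ lfunctionZeroBox χ a).Finite) :
    ∑ ρ ∈ hfd.toFinset, (zeroOrder χ ρ : ℝ) * (if |ρ.im| ≤ t then 1 else 0) =
      (lfunctionZeroCount χ t : ℝ) - lfunctionZeroCount χ a := by
  classical
  have hft : (lfunctionZeroBox χ t \ lfunctionZeroBox χ a).Finite :=
    (lfunctionZeroBox_finite hχ1 t).subset fun _ h ↦ h.1
  rw [count_sub_eq hχ1 hat, finsum_mem_eq_finite_toFinset_sum _ hft]
  have hfilter : hfd.toFinset.filter (fun ρ ↦ |ρ.im| ≤ t) = hft.toFinset := by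
    ext ρ
    rw [Finset.mem_filter, Set.Finite.mem_toFinset, Set.Finite.mem_toFinset, mem_window, mem_window]
    constructor
    · rintro ⟨⟨hb, hlt⟩, hle⟩
      obtain ⟨hz, h0, h1, -⟩ := mem_lfunctionZeroBox.1 hb
      exact ⟨mem_lfunctionZeroBox.2 ⟨hz, h0, h1, hle⟩, hlt⟩
    · rintro ⟨ht, hlt⟩
      obtain ⟨hz, h0, h1, hle⟩ := mem_lfunctionZeroBox.1 ht
      exact ⟨⟨mem_lfunctionZeroBox.2 ⟨hz, h0, h1, hle.trans htb⟩, hlt⟩, hle⟩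
  rw [← hfilter, Finset.sum_filter]
  refine Finset.sum_congr rfl fun ρ _ ↦ ?_
  split_ifs <;> simp

/-- **Partial summation of a window sum against `N(t, χ)`** (Rosser–Schoenfeld Lemma 7, χ-twin of the tree's
`SchoenfeldBound.sum_zerosBetween_eq`): for `a ≤ b` and `F ∈ C¹[a, b]`,
`∑_{a<|γ|≤b} m F(|γ|) = (N(b) − N(a)) F(b) − ∫_a^b (N(t) − N(a)) F'(t) dt`. -/
theorem finsum_window_eq (hχ1 : χ ≠ 1) {a b : ℝ} (hab : a ≤ b) {F F' : ℝ → ℝ}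
    (hF : ∀ t ∈ Icc a b, HasDerivAt F (F' t) t) (hF' : ContinuousOn F' (Icc a b)) :
    ∑ᶠ ρ ∈ lfunctionZeroBox χ b \ lfunctionZeroBox χ a, (zeroOrder χ ρ : ℝ) * F |ρ.im| =
      ((lfunctionZeroCount χ b : ℝ) - lfunctionZeroCount χ a) * F b -
        ∫ t in a..b, ((lfunctionZeroCount χ t : ℝ) - lfunctionZeroCount χ a) * F' t := by
  classical
  have hfd : (lfunctionZeroBox χ b \ lfunctionZeroBox χ a).Finite :=
    (lfunctionZeroBox_finite hχ1 b).subset fun _ h ↦ h.1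
  rw [finsum_mem_eq_finite_toFinset_sum _ hfd]
  set D := hfd.toFinset with hD
  have hmemD : ∀ ρ, ρ ∈ D → a < |ρ.im| ∧ |ρ.im| ≤ b := fun ρ hρ ↦ by
    rw [hD, Set.Finite.mem_toFinset, mem_window] at hρ
    exact ⟨hρ.2, (mem_lfunctionZeroBox.1 hρ.1).2.2.2⟩
  -- each zero: `F |γ| = F b − ∫_a^b 1_{|γ| ≤ t} F'`
  have hone : ∀ ρ ∈ D, F |ρ.im| = F b - ∫ t in a..b, (if |ρ.im| ≤ t then (1 : ℝ) else 0) * F' t := by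
    intro ρ hρ
    obtain ⟨h3, h4⟩ := hmemD ρ hρ
    rw [SchoenfeldBound.integral_indicator_mul_eq h3 h4 hF']
    have hderiv : ∀ t ∈ uIcc |ρ.im| b, HasDerivAt F (F' t) t := fun t ht ↦ by
      rw [uIcc_of_le h4] at ht
      exact hF t ⟨h3.le.trans ht.1, ht.2⟩
    have hint : IntervalIntegrable F' volume |ρ.im| b :=
      (hF'.mono (Icc_subset_Icc h3.le le_rfl)).intervalIntegrable_of_Icc h4
    rw [integral_eq_sub_of_hasDerivAt hderiv hint]
    ring
  have hint : ∀ ρ ∈ D, IntervalIntegrable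
      (fun t ↦ (zeroOrder χ ρ : ℝ) * ((if |ρ.im| ≤ t then (1 : ℝ) else 0) * F' t)) volume a b := by
    intro ρ _
    have hg' : IntegrableOn F' (Ioc a b) volume := hF'.integrableOn_Icc.mono_set Ioc_subset_Icc_self
    have heq : (fun t ↦ (if |ρ.im| ≤ t then (1 : ℝ) else 0) * F' t) = (Ici |ρ.im|).indicator F' := by
      funext t
      by_cases h : |ρ.im| ≤ t
      · rw [if_pos h, one_mul, Set.indicator_of_mem (show t ∈ Ici |ρ.im| from h)]
      · rw [if_neg h, zero_mul, Set.indicator_of_notMem (show t ∉ Ici |ρ.im| from h)]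
    refine IntervalIntegrable.const_mul ?_ _
    rw [intervalIntegrable_iff_integrableOn_Ioc_of_le hab, heq]
    exact hg'.indicator measurableSet_Ici
  have hcount : (lfunctionZeroCount χ b : ℝ) - lfunctionZeroCount χ a = ∑ ρ ∈ D, (zeroOrder χ ρ : ℝ) := by
    rw [count_sub_eq hχ1 hab, finsum_mem_eq_finite_toFinset_sum _ hfd]
  calc ∑ ρ ∈ D, (zeroOrder χ ρ : ℝ) * F |ρ.im|
      = ∑ ρ ∈ D, ((zeroOrder χ ρ : ℝ) * F b -
          ∫ t in a..b, (zeroOrder χ ρ : ℝ) * ((if |ρ.im| ≤ t then (1 : ℝ) else 0) * F' t)) := by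
        refine Finset.sum_congr rfl fun ρ hρ ↦ ?_
        rw [hone ρ hρ, intervalIntegral.integral_const_mul]
        ring
    _ = (∑ ρ ∈ D, (zeroOrder χ ρ : ℝ)) * F b -
          ∫ t in a..b, ∑ ρ ∈ D, (zeroOrder χ ρ : ℝ) * ((if |ρ.im| ≤ t then (1 : ℝ) else 0) * F' t) := by
        rw [Finset.sum_sub_distrib, Finset.sum_mul, intervalIntegral.integral_finsetSum hint]
    _ = ((lfunctionZeroCount χ b : ℝ) - lfunctionZeroCount χ a) * F b -
          ∫ t in a..b, ((lfunctionZeroCount χ t : ℝ) - lfunctionZeroCount χ a) * F' t := by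
        rw [← hcount]
        congr 1
        refine intervalIntegral.integral_congr fun t ht ↦ ?_
        rw [uIcc_of_le hab] at ht
        rw [← sum_indicator_eq_count_sub hχ1 ht.1 ht.2 hfd, Finset.sum_mul]
        refine Finset.sum_congr rfl fun ρ _ ↦ ?_
        ring

/-- `t ↦ (N(t) − N(a)) g(t)` is interval integrable for `g` continuous (`N` is monotone). -/
theorem intervalIntegrable_count_sub_mul (hχ1 : χ ≠ 1) {a c d : ℝ} {g : ℝ → ℝ} (hg : ContinuousOn g (uIcc c d)) :
    IntervalIntegrable (fun t ↦ ((lfunctionZeroCount χ t : ℝ) - lfunctionZeroCount χ a) * g t) volume c d := by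
  have hmono : Monotone fun t ↦ ((lfunctionZeroCount χ t : ℝ) - lfunctionZeroCount χ a) :=
    fun s t hst ↦ by linarith [count_mono hχ1 hst]
  exact (hmono.intervalIntegrable).mul_continuousOn hg

/-! ### The RH-free remainder at every height -/

/-- Off a finite set of ordinates there is room: every open interval contains a height `s` with `±s` the
ordinate of no non-trivial zero (`χ ≠ χ₀`). -/
theorem exists_nonordinate (hχ1 : χ ≠ 1) {u v : ℝ} (huv : u < v) :
    ∃ s ∈ Ioo u v, (∀ ρ ∈ charNontrivialZeros χ, ρ.im ≠ s) ∧ ∀ ρ ∈ charNontrivialZeros χ, ρ.im ≠ -s := by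
  classical
  set R := max |u| |v| with hR
  have hfin := lfunctionZeroBox_finite hχ1 R
  have hbad : ((fun ρ : ℂ ↦ ρ.im) '' lfunctionZeroBox χ R ∪ (fun ρ : ℂ ↦ -ρ.im) '' lfunctionZeroBox χ R).Finite :=
    (hfin.image _).union (hfin.image _)
  obtain ⟨s, hs, hsbad⟩ := (Set.Ioo_infinite huv).exists_notMem_finset hbad.toFinset
  rw [Set.Finite.mem_toFinset, Set.mem_union, not_or] at hsbad
  have hsR : |s| ≤ R := by
    rw [hR, abs_le]
    constructor
    · have : -|u| ≤ u := neg_abs_le u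
      have : |u| ≤ max |u| |v| := le_max_left _ _
      linarith [hs.1]
    · exact (le_abs_self v).trans (le_max_right _ _) |>.trans' hs.2.le
  refine ⟨s, hs, fun ρ hρ hρs ↦ hsbad.1 ?_, fun ρ hρ hρs ↦ hsbad.2 ?_⟩
  · refine ⟨ρ, ?_, hρs⟩
    rw [lfunctionZeroBox_eq_inter]
    exact ⟨hρ, by rw [Set.mem_setOf_eq, hρs]; exact hsR⟩
  · refine ⟨ρ, ?_, by simp only [hρs, neg_neg]⟩
    rw [lfunctionZeroBox_eq_inter]
    exact ⟨hρ, by rw [Set.mem_setOf_eq, hρs, abs_neg]; exact hsR⟩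

omit [NeZero q] in
/-- `charCountMainExact χ` is continuous (the `Γ`-phase is differentiable). -/
theorem continuous_charCountMainExact (χ : DirichletCharacter ℂ q) : Continuous (charCountMainExact χ) := by
  have hθ : Continuous (gammaArgPhase (charParity χ)) :=
    continuous_iff_continuousAt.2 fun t ↦ (hasDerivAt_gammaArgPhase (charParity χ) t).continuousAt
  have e : charCountMainExact χ = fun t ↦ (2 * gammaArgPhase (charParity χ) t + t * Real.log q) / Real.pi := by
    funext t; rfl
  rw [e]
  fun_prop

/-- **The tree's counting remainder AT EVERY HEIGHT** (MV Cor. 14.7 with the `Γ`-phase exact; the tree proves it off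
ordinates, `DirichletTheta.abs_lfunctionZeroCount_sub_le`): for `χ` primitive mod `q > 1` and every `t > 0`,
`|N(t, χ) − charCountMainExact χ t| ≤ 5 + 2 log(2 ζ(5/4) q (t+4))/log(7/6)`.  Extension by monotonicity of `N`,
continuity of the main term and of the majorant, and density of non-ordinates. -/
theorem abs_count_sub_exact_le (hχ : χ.IsPrimitive) (hq : 1 < q) {t : ℝ} (ht : 0 < t) :
    |(lfunctionZeroCount χ t : ℝ) - charCountMainExact χ t| ≤
      5 + 2 * (Real.log (2 * (q * (t + 4) * DirichletDisc.Zc)) / Real.log (7 / 6)) := by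
  have hχ1 : χ ≠ 1 := ne_one_of_isPrimitive hχ hq
  have hq1 : q ≠ 1 := by omega
  have hq0 : (0 : ℝ) < q := by exact_mod_cast (lt_trans zero_lt_one hq)
  have hZ : 1 ≤ DirichletDisc.Zc := DirichletDisc.one_le_Zc
  set M : ℝ → ℝ := charCountMainExact χ with hM
  set R : ℝ → ℝ := fun s ↦ 5 + 2 * (Real.log (2 * (q * (s + 4) * DirichletDisc.Zc)) / Real.log (7 / 6)) with hR
  -- the tree bound off ordinates
  have htree : ∀ s : ℝ, 0 < s → (∀ ρ ∈ charNontrivialZeros χ, ρ.im ≠ s) →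
      (∀ ρ ∈ charNontrivialZeros χ, ρ.im ≠ -s) → |(lfunctionZeroCount χ s : ℝ) - M s| ≤ R s := by
    intro s hs h1 h2
    exact abs_lfunctionZeroCount_sub_le hχ hq1 hs h1 h2
  -- continuity of `M` and `R` at `t`
  have hMc : ContinuousAt M t := (continuous_charCountMainExact χ).continuousAt
  have hRc : ContinuousAt R t := by
    have : 2 * (q * (t + 4) * DirichletDisc.Zc) ≠ 0 := by positivity
    simp only [hR]
    fun_prop (disch := assumption)
  change |(lfunctionZeroCount χ t : ℝ) - M t| ≤ R t
  refine le_of_forall_pos_lt_add fun ε hε ↦ ?_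
  obtain ⟨δ₁, hδ₁, hM1⟩ := Metric.continuousAt_iff.1 hMc (ε / 3) (by positivity)
  obtain ⟨δ₂, hδ₂, hR2⟩ := Metric.continuousAt_iff.1 hRc (ε / 3) (by positivity)
  set δ := min (min δ₁ δ₂) (t / 2) with hδ
  have hδpos : 0 < δ := by positivity
  have hδ1 : δ ≤ δ₁ := (min_le_left _ _).trans (min_le_left _ _)
  have hδ2 : δ ≤ δ₂ := (min_le_left _ _).trans (min_le_right _ _)
  have hδt : δ ≤ t / 2 := min_le_right _ _
  -- a non-ordinate height just above and just below `t`
  obtain ⟨s, hs, hs1, hs2⟩ := exists_nonordinate hχ1 (show t < t + δ by linarith)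
  obtain ⟨r, hr, hr1, hr2⟩ := exists_nonordinate hχ1 (show t - δ < t by linarith)
  have hs0 : 0 < s := by linarith [hs.1]
  have hr0 : 0 < r := by linarith [hr.1]
  have hNs : (lfunctionZeroCount χ t : ℝ) ≤ lfunctionZeroCount χ s := count_mono hχ1 hs.1.le
  have hNr : (lfunctionZeroCount χ r : ℝ) ≤ lfunctionZeroCount χ t := count_mono hχ1 hr.2.le
  have h1 := abs_le.1 (htree s hs0 hs1 hs2)
  have h2 := abs_le.1 (htree r hr0 hr1 hr2)
  have dMs : dist (M s) (M t) < ε / 3 := hM1 (by rw [Real.dist_eq, abs_lt]; constructor <;> linarith [hs.1, hs.2])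
  have dMr : dist (M r) (M t) < ε / 3 := hM1 (by rw [Real.dist_eq, abs_lt]; constructor <;> linarith [hr.1, hr.2])
  have dRs : dist (R s) (R t) < ε / 3 := hR2 (by rw [Real.dist_eq, abs_lt]; constructor <;> linarith [hs.1, hs.2])
  have dRr : dist (R r) (R t) < ε / 3 := hR2 (by rw [Real.dist_eq, abs_lt]; constructor <;> linarith [hr.1, hr.2])
  rw [Real.dist_eq, abs_lt] at dMs dMr dRs dRr
  rw [abs_lt]
  constructor <;> linarith [h1.1, h1.2, h2.1, h2.2]

/-- The same bound in the route's vocabulary: `|N(t, χ) − charCountMainExact χ t| ≤ argSRem q t + 0.014` (`t > 0`;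
`ζ(5/4) ≤ 4.6` and `2/log(7/6) ≤ 12.975`, `CountNumerics`). -/
theorem abs_count_sub_exact_le_argSRem (hχ : χ.IsPrimitive) (hq : 1 < q) {t : ℝ} (ht : 0 < t) :
    |(lfunctionZeroCount χ t : ℝ) - charCountMainExact χ t| ≤ argSRem q t + 0.014 := by
  have hq2 : (2 : ℝ) ≤ q := by exact_mod_cast hq
  have hX : (1 : ℝ) ≤ q * (t + 4) := by nlinarith
  have h := remainder_le hX
  refine (abs_count_sub_exact_le hχ hq ht).trans ?_
  unfold argSRem
  rw [show (9.1902 : ℝ) * q * (t + 4) = 9.1902 * (q * (t + 4)) by ring]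
  linarith

end CharCount

end Summit.RiemannHypothesis.RiemannHypothesis.Theorems.LiTheory

end
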